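import Literature.Probability.LatticeModels.FKIsingInterfaceSLEProofs
import Literature.Probability.LatticeModels.FKIsingRSWHolds
import HarnessLib

/-!
# Discharges of named facts of `FKIsingInterfaceSLE.lean`

`Literature/Probability/LatticeModels/FKIsingInterfaceSLEHolds.lean` — proofs-only sibling of
`FKIsingInterfaceSLE.lean` (no definitions, no named facts). Each theorem below closes a named
fact `X : Prop` of that file as `X_holds : X` by composing an ACCEPTED reduction theorem of
the tree with the ACCEPTED unconditional `_holds` discharges of all of its hypotheses; nothing
is re-proved and no statement is changed. Recorded by the librarian sweep g25 (2026-08-16,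
pass 5c: facts dischargeable in one line from the tree's own lemmas), so that the facts
census, `#h21_route_deps` and the cone guardrail see these facts as theorems.

Discharged here:

* `isTightAlongMesh_fkInterfaceCurve_holds` :=
  `isTightAlongMesh_fkInterfaceCurve_of_fkIsing_rsw` `fkIsing_rsw_holds`
  (`FKIsingInterfaceSLEProofs.lean`).

## References

* [CDHKSCRAS2014] — see `lean/references.bib` and the docstring of the fact in `FKIsingInterfaceSLE.lean`.
* [DuminilCopinSmirnov2012Clay] — see `lean/references.bib` and the docstring of the fact in `FKIsingInterfaceSLE.lean`.
-/

namespace Literature.Probability.LatticeModels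

/-- **Discharge of the named fact `isTightAlongMesh_fkInterfaceCurve`**
(`FKIsingInterfaceSLE.lean`): (T) Tightness of critical FK-Ising Dobrushin interfaces
(Duminil-Copin–Smirnov, Clay Math. Proc. 15 (2012), Thm. 6.1: "Fix a domain `(Ω, a, b)`. … —
obtained as `isTightAlongMesh_fkInterfaceCurve_of_fkIsing_rsw` applied to the tree's
unconditional discharge `fkIsing_rsw_holds` of its hypothesis (reduction in
`FKIsingInterfaceSLEProofs.lean`).
[cite: DuminilCopinSmirnov2012Clay, Thm. 6.1]
[cite: CDHKSCRAS2014, §2 Thm. 3 and Thm. 4] -/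
theorem isTightAlongMesh_fkInterfaceCurve_holds :
    isTightAlongMesh_fkInterfaceCurve :=
  isTightAlongMesh_fkInterfaceCurve_of_fkIsing_rsw fkIsing_rsw_holds

end Literature.Probability.LatticeModels
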